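import Literature.AlgebraicGeometry.Resolution.ArithmeticalThreefoldsHeadReduction
import HarnessLib

/-!
# Cossart–Piltant 2019, Prop. 4.8 decomposed: surface resolution and the geometric head of the
# printed descent

Topic `AlgebraicGeometry/Resolution`; namespace `Literature.AlgebraicGeometry.Resolution`.
Fact-decomposition file (librarian 2026-08-16) for the named fact
`Literature.AlgebraicGeometry.Resolution.CossartPiltant2019LU3OfComplete`
(`ArithmeticalThreefolds.lean`; V. Cossart, O. Piltant, *Resolution of singularities of
arithmetical threefolds*, J. Algebra 529 (2019) 268–535 = arXiv:1412.0868, journal Prop. 4.8 =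
arXiv v1 Prop. 4.6, pp. 52–53: "Assume that (LU) holds for every complete local domain of
dimension three. Then theorem 1.1 holds", vendored as
`CossartPiltant2019LUComplete3 → CossartPiltant2019LU3`).

State of the tree (`ArithmeticalThreefoldsHeadReduction.lean` and the nine proof files it
assembles). The printed proof descends (LU) from `Â` to `A` along a valuation; ALL of its
commutative algebra after the construction of the regular local ring `𝒪_{Ŷ,ŷ}` with its
monomial regular system of parameters is proved, and `CossartPiltant2019LU3OfComplete.of_head`
derives the fact from

* `CossartJannsenSaito2020` — resolution of excellent surfaces (the input [L3] of the patching
  proposition, journal Prop. 4.6, used for the affine models of dimension `≤ 2` and the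
  non-closed centres; existing named fact), and
* the **geometric head** of the printed proof — for the local rings `A = B_𝔭` (`B` a domain of
  finite type over a field, `𝔭` maximal, `dim B = dim B_𝔭 = 3`), given the data of the descent
  (a valuation ring `O` of `K = Frac A` dominating `A` with algebraic residue extension, a field
  `K̂₁` under `Â` with kernel a minimal prime and `K̂₁ = Frac(Â/P̂₁)`, an embedding `ι : K → K̂₁`
  over `A`, a valuation ring `O'` of `K̂₁` dominating `Â` with `O' ∩ K = O`), produce a regular
  local ring `S` (`= 𝒪_{Ŷ,ŷ}`) essentially of finite type over `Â`, dominating `Â`, inside `K̂₁`,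
  dominated by `O'`, with generators `z_j` of `𝔪_S`, exponents `a_j ≥ 1`, units `c_j` and
  `g_j ∈ K` with `ι(g_j) = c_j z_j^{a_j}` — the output of Thm. 1.1 for `Spec Â` (by the hypothesis
  `CossartPiltant2019LUComplete3` and patching), v1 Lemma 4.7 (= [CoP1] Prop. 6.2 with embedded
  resolution of surfaces, Prop. 4.2) and the density step (511)–(512); it entered the tree only
  as the plain binder `head` of `.of_head`.

This file NAMES the head (the explicit exception of 2026-08-16 to D-0027 A7 for budget-capped
facts) and records the assembly:

* `CossartPiltant2019_descentHead` — **named fact**, verbatim the binder `head` of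
  `CossartPiltant2019LU3OfComplete.of_head` (an implication from `CossartPiltant2019LUComplete3`,
  as in the source: "By assumption in this proposition and proposition 4.4, theorem 1.1 holds
  for `X̂`");
* `CossartPiltant2019LU3OfComplete_holds_of` — **the assembly, PROVED**: surface resolution and
  the head imply the fact (`.of_head`).

## References

* V. Cossart, O. Piltant, J. Algebra 529 (2019) 268–535 = arXiv:1412.0868: Props. 4.6, 4.8 and
  Lemma 4.7 (arXiv v1: Props. 4.4, 4.6, pp. 50–53). [CossartPiltant2019]
* V. Cossart, U. Jannsen, S. Saito, *Desingularization: invariants and strategy*, LNM 2270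
  (2020) (resolution of excellent surfaces). [CossartJannsenSaito2020]

## Design notes

* The head is kept as ONE statement in the exact format consumed by `.of_head` (rather than cut
  into Thm. 1.1-for-`Spec Â` / Lemma 4.7 / density), because the intermediate objects — a
  projective resolution `Ŷ → Spec Â` and the centre of `v̂` on it — have no carrier in the tree;
  the format quantifies only over rings, valuation subrings and the adic completion of Mathlib.
-/

noncomputable section

namespace Literature.AlgebraicGeometry.Resolution

universe u

open IsLocalRing

/-- **The geometric head of the printed proof of Cossart–Piltant 2019, Prop. 4.8** (arXiv v1
Prop. 4.6, pp. 52–53: "By assumption in this proposition and proposition 4.4, theorem 1.1 holds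
for `X̂ := Spec Â`. Let `Ŷ → X̂` be a resolution, `ŷ` the centre of `v̂` … by lemma 4.7 … there is a
regular system of parameters `(û₁, …, û_d)` of `𝒪_{Ŷ,ŷ}` with `g_j = γ_j û_j^{a_j}`, `γ_j` a unit,
`g_j ∈ K`" (with the density step (511)–(512))). Statement, for `A = B_𝔭` with `B` a domain of
finite type over a field `k`, `𝔭` maximal and `dim B = dim B_𝔭 = 3`, assuming
`CossartPiltant2019LUComplete3` ((LU) for complete local domains of dimension three): for every
valuation ring `O` of `K = Frac A` containing `A`, centred on `𝔪_A`, with residue field algebraic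
over that of `A`; every field `K₁` under `Â = AdicCompletion 𝔪_A A` whose kernel is a minimal
prime and which is the fraction field of the image; every ring map `ι : K → K₁` compatible with
`A → Â`; and every valuation ring `O'` of `K₁` containing `Â`, centred on `𝔪_A Â`, with residue
field algebraic over `Â`, and with `O'.comap ι = O` — there is a regular local ring `S`,
essentially of finite type over `Â` by a local homomorphism, with an injective `Â`-algebra map
`S → K₁` landing in `O'` and sending `𝔪_S` into the maximal ideal of `O'`, together with finitely
many `z_j ∈ S` spanning `𝔪_S`, exponents `a_j > 0`, units `c_j ∈ Sˣ` and `g_j ∈ K` with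
`ι(g_j) = c_j z_j^{a_j}` in `K₁`. This is verbatim the binder `head` of
`CossartPiltant2019LU3OfComplete.of_head` (`ArithmeticalThreefoldsHeadReduction.lean`); all such
data `O, K₁, ι, O'` exist (`exists_minimalPrime_valuationSubring_adicCompletion`). Named fact
(statement only). [cite: CossartPiltant2019, Prop. 4.8 with Lemma 4.7 (arXiv v1: Prop. 4.6, pp. 52–53)] -/
def CossartPiltant2019_descentHead : Prop :=
  CossartPiltant2019LUComplete3.{u} →
    ∀ (k B : Type u) [Field k] [CommRing B] [IsDomain B] [Algebra k B] [Algebra.FiniteType k B]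
      (p : Ideal B) [p.IsMaximal], ringKrullDim B = 3 →
      ringKrullDim (Localization.AtPrime p) = 3 →
    ∀ (K : Type u) [Field K] [Algebra (Localization.AtPrime p) K]
      [IsFractionRing (Localization.AtPrime p) K] (O : ValuationSubring K),
    (∀ x : Localization.AtPrime p, algebraMap _ K x ∈ O) →
    (∀ x ∈ maximalIdeal (Localization.AtPrime p), O.valuation (algebraMap _ K x) < 1) →
    (∀ y : O, ∃ q : Polynomial (Localization.AtPrime p),
      (∃ i, q.coeff i ∉ maximalIdeal (Localization.AtPrime p)) ∧
      O.valuation (q.eval₂ (algebraMap _ K) y) < 1) →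
    ∀ (K₁ : Type u) [Field K₁]
      [Algebra (AdicCompletion (maximalIdeal (Localization.AtPrime p))
        (Localization.AtPrime p)) K₁],
    RingHom.ker (algebraMap (AdicCompletion (maximalIdeal (Localization.AtPrime p))
        (Localization.AtPrime p)) K₁) ∈
      minimalPrimes (AdicCompletion (maximalIdeal (Localization.AtPrime p))
        (Localization.AtPrime p)) →
    (∀ z : K₁, ∃ a b : AdicCompletion (maximalIdeal (Localization.AtPrime p))
        (Localization.AtPrime p), z = algebraMap _ K₁ a / algebraMap _ K₁ b) →
    ∀ (ι : K →+* K₁), ι.comp (algebraMap (Localization.AtPrime p) K) =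
      (algebraMap (AdicCompletion (maximalIdeal (Localization.AtPrime p))
        (Localization.AtPrime p)) K₁).comp (algebraMap (Localization.AtPrime p) _) →
    ∀ (O' : ValuationSubring K₁),
    (∀ x : AdicCompletion (maximalIdeal (Localization.AtPrime p)) (Localization.AtPrime p),
      algebraMap _ K₁ x ∈ O') →
    (∀ x ∈ (maximalIdeal (Localization.AtPrime p)).map (algebraMap (Localization.AtPrime p)
        (AdicCompletion (maximalIdeal (Localization.AtPrime p)) (Localization.AtPrime p))),
      O'.valuation (algebraMap _ K₁ x) < 1) →
    (∀ y : O', ∃ q : Polynomial (AdicCompletion (maximalIdeal (Localization.AtPrime p))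
        (Localization.AtPrime p)),
      (∃ i, q.coeff i ∉ (maximalIdeal (Localization.AtPrime p)).map
        (algebraMap (Localization.AtPrime p)
          (AdicCompletion (maximalIdeal (Localization.AtPrime p)) (Localization.AtPrime p)))) ∧
      O'.valuation (q.eval₂ (algebraMap _ K₁) y) < 1) →
    O'.comap ι = O →
    ∃ (S : Type u) (_ : CommRing S) (_ : IsRegularLocalRing S)
      (_ : Algebra (AdicCompletion (maximalIdeal (Localization.AtPrime p))
        (Localization.AtPrime p)) S) (_ : Algebra S K₁),
      IsLocalHom (algebraMap (AdicCompletion (maximalIdeal (Localization.AtPrime p))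
        (Localization.AtPrime p)) S) ∧
      Algebra.EssFiniteType (AdicCompletion (maximalIdeal (Localization.AtPrime p))
        (Localization.AtPrime p)) S ∧
      IsScalarTower (AdicCompletion (maximalIdeal (Localization.AtPrime p))
        (Localization.AtPrime p)) S K₁ ∧
      Function.Injective (algebraMap S K₁) ∧
      (∀ s : S, algebraMap S K₁ s ∈ O') ∧
      (∀ s ∈ maximalIdeal S, O'.valuation (algebraMap S K₁ s) < 1) ∧
      ∃ (d : ℕ) (z : Fin d → S) (a : Fin d → ℕ) (c : Fin d → Sˣ) (g : Fin d → K),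
        Ideal.span (Set.range z) = maximalIdeal S ∧ (∀ j, 0 < a j) ∧
        ∀ j, ι (g j) = algebraMap S K₁ (c j * z j ^ a j)

/-- **`CossartPiltant2019LU3OfComplete` (journal Prop. 4.8) from its two children**: resolution
of excellent surfaces (`CossartJannsenSaito2020`, the input [L3] of the patching Prop. 4.6) and
the geometric head of the printed descent (`CossartPiltant2019_descentHead`) imply the fact — the
tree's `CossartPiltant2019LU3OfComplete.of_head`, in which the reductions to closed points of
three-dimensional affine models and all the commutative algebra of pp. 52–53 after the head are
proved. [cite: CossartPiltant2019, Props. 4.6 and 4.8 (arXiv v1: Props. 4.4 and 4.6, pp. 50–53)] -/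
theorem CossartPiltant2019LU3OfComplete_holds_of (hCJS : CossartJannsenSaito2020.{u})
    (hH : CossartPiltant2019_descentHead.{u}) : CossartPiltant2019LU3OfComplete.{u} :=
  CossartPiltant2019LU3OfComplete.of_head hCJS hH

end Literature.AlgebraicGeometry.Resolution

end
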